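import Summits.HubbardSuperconductivity.HubbardSuperconductivity.Theorems.AnisotropyChordTransferFibre3FinXDEval

/-!
# Route `AnisotropyChord` / H0 rotor rung: FIN per-`L` row-D evaluator XD — the cover checks (computable, zero data)

The Boolean cover layer of the per-`L` row-D certificate (definitions only; soundness in `…Fibre3FinXDCover`): one cell of the cover is
numerator-vacuous, `Δ`-vacuous on either side of `(0, Δ₁]`, or certified by `xdCellOK` (`xdCellAnyT`, point tables as arguments;
`xdCellAny0` recomputes them in the kernel), and the per-`L` certificate `xdCheck L Δ₁ cells` (points from `0` to `≥ lamTop L`, every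
consecutive pair a passing cell, g5's `cellsAllQ`).  Kernel facts `xdCellAny0 L Δ₁ la lb aD = true` are certified per cell in part files.
Prover seat `hubbard-h0-rotor-p3` g7; helper for piece A = stmt-HubbardSuperconductivity-23918 of rung 19089 (`--supports`, helper class).
WHAT THIS IS NOT: nothing here proves superconductivity in the Hubbard model (rotor TARGET as worded stays FALSE, g15 verdict); evaluator
infrastructure for the FIN certificates of ONE conditional reduction.  Tree imports only; no sorry, no new axioms.
-/

set_option linter.dupNamespace false
set_option autoImplicit false

namespace Summit.HubbardSuperconductivity.HubbardSuperconductivity.Theorems.AnisotropyChord.Transfer.Fibre3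

namespace FinXD

open Hole2 FinCell FinXB

/-- one cell of the cover, given the point tables: numerator-vacuous, `Δ`-vacuous on either side of `(0, Δ₁]`, or certified. -/
def xdCellAnyT (L : ℕ) (d1 : ℚ) (la lb : ℤ) (aD : ℚ) (ptLo ptHi : XDPt) : Bool :=
  (denCellPos L (cosTab L) la lb && decide ((numIv L la lb).2 < 0) && decide (0 ≤ (G0Iv L la lb).1)) ||
  (groundCellCheck L la lb &&
    (decide ((deltaIv L la lb).2 < 0) || decide (d1 * (D : ℚ) < (((deltaIv L la lb).1 : ℤ) : ℚ)))) ||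
  xdCellOK L la lb aD ptLo ptHi

/-- ★ one cell of the cover with the point tables recomputed (a kernel fact `xdCellAny0 … = true` may instead rewrite
`xdPoint L la`, `xdPoint L lb` to certified literal tables and decide `xdCellAnyT`). -/
def xdCellAny0 (L : ℕ) (d1 : ℚ) (la lb : ℤ) (aD : ℚ) : Bool := xdCellAnyT L d1 la lb aD (xdPoint L la) (xdPoint L lb)

/-- ★ THE PER-`L` ROW-D CERTIFICATE on `0 < Δ ≤ Δ₁`: points start at `0`, end `≥ lamTop L`, every cell passes `xdCellAny0`. -/
def xdCheck (L : ℕ) (d1 : ℚ) (cells : List (ℤ × ℚ)) : Bool :=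
  decide ((cells.head?.map Prod.fst) = some 0) && decide (2 ≤ cells.length) && decide (lamTop L ≤ cellsLastQ cells)
    && cellsAllQ (xdCellAny0 L d1) cells

end FinXD

end Summit.HubbardSuperconductivity.HubbardSuperconductivity.Theorems.AnisotropyChord.Transfer.Fibre3
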